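import Summits.QuantumFields.BalabanUV.Beta.GAN24.SandwichDecimate
import Summits.QuantumFields.BalabanUV.Beta.GAN24.TaylorSandwich

/-!
# `BalabanUV.Beta.GAN24.SandwichDecimateVertex` — binder row G-an2-4 / (CONV-C), S-slot («E3Shape» ∧ «E3SupRate»), road «S3-Taylor»: generic leaf
# «SANDWICH-DECIMATE*» under RATE row **R3-dL**, part 2 of 2 — THE ONE-CHANNEL UNIT SANDWICH OF `TaylorSandwich.sandwich_bound` ACROSS ONE SCALE: the
# block-averaged VERTEX factor commutes with the lift, and the literal interface `sandwich_decimate` ∕ `sandwich_decimate_avgLift` (unit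
# `b2b-balaban-gan24-formalise-leaf-04`, gen 20; INTENT «SANDWICH-DECIMATE*» CLAIMS l.5485; interface = leaf-11-g15's «WRITE IT» l.5446 (b))

NOT IN PRINT; OUR BOOKKEEPING.  HONEST FRAMING (cell contract, verbatim): «discharging `BetaPertH` makes Bałaban's UV stability UNCONDITIONAL —
a real constructive-QFT result; it is NOT the continuum limit and NOT the Clay problem.»  HONEST DEPENDENCY (verbatim): «continuum YM on T⁴ ⇐
BetaPertH ∧ nine spine estimates (0/9 proved); BetaPertH ⇐ (D1) ∧ (D4) ∧ CAP+tail; G-an2-4 gates asym, D1 and NE2/3/4.»  [folklore] lattice-sum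
bookkeeping over an2's TYPED scale maps BY NAME (`InterLevelTransport.avgLift`∕`onLat`∕`cwsum_apply`∕`onLat_zsmul`∕`legOff`, `OneStepKernelFamily.legSet`∕
`legPt`∕`legW`, leaf-05's `ScaleNesting.avgLift_avgLift'`), part 1 (`GAN24/SandwichDecimate`: `decLeg`, `abs_decLeg_le`∕`abs_leg_transfer'`,
`lift_adjoint_decLeg`) and the row owner's `TaylorSandwich.sandwich_summable`∕`sandwich_bound` BY NAME; generic `d`; 0 def, 0 cite, 0 `def … : Prop`,
no estimate of (N1)∕(N1-Cauchy)∕the K-slot, nothing asserted of Bałaban's objects; NOTHING of (hS, hSall)∕«E3Shape»∕«E3SupRate» discharged; moves no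
row by itself.  NOT summit progress; NOT BetaPertH, NOT continuum, NOT Clay.

## CONTENTS ([folklore]; field legs `Sum.inl l` only; `N`, `Nb = P·N` the two blockings, `N′`, `Nb′ ≠ 0` ARBITRARY coarse spacings of the vertex extension)
§2 the lift versus superpositions of the kernel: `avgLift_finset_sum_mul` (finite linear combinations), `tsum_mul_avgLift` (summable superpositions),
   `vertexSum_avgLift` (the `onLat`-form vertex sum of the sandwich, any two coarse spacings — `ψ` is read at the coarse index on both sides).
§4 `inv_pow_mul`, `inner_factor_eq` (the big member's block-averaged vertex factor = `P^{−(d+1)}` × the lift of the small member's), and the interface: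
   **`sandwich_decimate`** — generic coarse-indexed table family `G μ Y`, big table `avgLift P (G μ Y)`:
   `Σ'_y Σ_{l′} (Σ'_w Σ_l A l w · Σ_μ Nb^{−(d+1)} Σ'_v onLat Nb′ (ψ μ) v · onLat Nb′ (avgLift P ∘ G μ) v w y l l′) · B l′ y
      = P^{−(d+1)} · Σ'_ȳ Σ_{l′} (Σ'_w̄ Σ_l decLeg P A l w̄ · Σ_μ N^{−(d+1)} Σ'_v onLat N′ (ψ μ) v · onLat N′ (G μ) v w̄ ȳ l l′) · decLeg P B l′ ȳ`
   (summabilities `hV`∕`hW`∕`hY` on the SMALL side); `summable_pieces_of_legs` + **`sandwich_decimate_of_legs`** (the same from `sandwich_bound`'s own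
   hypothesis list for the SMALL member plus the BIG member's outer-leg decay); **`abs_sandwich_decimate_le`** (the bound across one scale: constants
   `CA·e^{κ}`, `CB·e^{κ}`); **`sandwich_decimate_avgLift`** ∕ **`sandwich_decimate_avgLift_of_legs`** (`G μ Y := avgLift M (K μ Y)`, big table
   `avgLift Mb (K μ Y)`, `Mb = P·M` — leaf-11-g15's (b) up to their names).
-/

noncomputable section

open Finset
open scoped BigOperators
open Literature.MathematicalPhysics.QuantumFieldTheory
open Literature.MathematicalPhysics.QuantumFieldTheory.Balaban1983to89
open Literature.MathematicalPhysics.QuantumFieldTheory.Balaban1983to89.Beta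
open Literature.Probability.LatticeModels (Torus.proj)
open AffineAveraging (Site)
open B12Sec2to5 (l1 l1_nonneg)
open ExpKernelCalculus (MKer Zl l1_sub_symm)
open LatticeForm (quo)
open OneStepResolventKernel (Fib quo_zsmul)
open OneStepKernelFamily (legSet legPt legW)
open InterLevelTransport (avgLift onLat cwsum cwsum_apply onLat_zsmul legOff)
open Summit.QuantumFields.BalabanUV.Beta.GAN24.ScaleNesting (avgLift_avgLift')
open Summit.QuantumFields.BalabanUV.Beta.GAN24.TaylorBlockSum (nonneg_of_dominated)
open Summit.QuantumFields.BalabanUV.Beta.GAN24.TaylorSandwich (sandwich_summable sandwich_bound)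

namespace Summit.QuantumFields.BalabanUV.Beta.GAN24.SandwichDecimate

variable {d : ℕ}

/-! ## §2 The averaging lift versus superpositions of the kernel -/

section Lift

variable (P : ℕ)

/-- [folklore] The lift is linear in the kernel: a finite linear combination of kernels lifts termwise (finite sums only). -/
theorem avgLift_finset_sum_mul {ι : Type*} (s : Finset ι) (c : ι → ℝ) (F : ι → MKer (d + 1) (Fib d))
    (x z : Site (d + 1)) (a b : Fib d) :
    avgLift P (fun x z a b => ∑ μ ∈ s, c μ * F μ x z a b) x z a b = ∑ μ ∈ s, c μ * avgLift P (F μ) x z a b := by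
  simp only [avgLift, Finset.mul_sum]
  conv_rhs => rw [Finset.sum_comm]
  refine Finset.sum_congr rfl fun i _ => ?_
  conv_rhs => rw [Finset.sum_comm]
  refine Finset.sum_congr rfl fun i' _ => ?_
  split_ifs with h
  · rw [Finset.mul_sum]
    exact Finset.sum_congr rfl fun μ _ => by ring
  · simp

/-- [folklore] **A SUMMABLE SUPERPOSITION LIFTS TERMWISE**: if every entry of `Y ↦ ψ Y · G Y` is summable then
`Σ'_Y ψ Y · avgLift P (G Y) = avgLift P (Σ'_Y ψ Y · G Y)` entrywise (the lift is a FINITE weighted sum of entries per entry; the lift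
conditions do not depend on `Y`). -/
theorem tsum_mul_avgLift (ψ : Site (d + 1) → ℝ) (G : Site (d + 1) → MKer (d + 1) (Fib d)) (x z : Site (d + 1)) (a b : Fib d)
    (hs : ∀ x' z', Summable fun Y => ψ Y * G Y x' z' a b) :
    ∑' Y, ψ Y * avgLift P (G Y) x z a b = avgLift P (fun x' z' a' b' => ∑' Y, ψ Y * G Y x' z' a' b') x z a b := by
  simp only [avgLift]
  -- each `(i, i′)`-piece is summable in `Y`
  have hpc : ∀ i i', Summable fun Y => ψ Y * (legW d P a * legW d P b *
      (if Torus.proj P (x - legOff P a i) = 0 ∧ Torus.proj P (z - legOff P b i') = 0 then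
        G Y (quo P (x - legOff P a i)) (quo P (z - legOff P b i')) a b else 0)) := by
    intro i i'
    by_cases h : Torus.proj P (x - legOff P a i) = 0 ∧ Torus.proj P (z - legOff P b i') = 0
    · simp only [h, and_self, if_true]
      exact ((hs _ _).mul_left (legW d P a * legW d P b)).congr fun Y => by ring
    · simp only [h, if_false, mul_zero]
      exact summable_zero
  calc ∑' Y, ψ Y * ∑ i ∈ legSet d P a, ∑ i' ∈ legSet d P b, legW d P a * legW d P b *
          (if Torus.proj P (x - legOff P a i) = 0 ∧ Torus.proj P (z - legOff P b i') = 0 then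
            G Y (quo P (x - legOff P a i)) (quo P (z - legOff P b i')) a b else 0)
      = ∑' Y, ∑ i ∈ legSet d P a, ∑ i' ∈ legSet d P b, ψ Y * (legW d P a * legW d P b *
          (if Torus.proj P (x - legOff P a i) = 0 ∧ Torus.proj P (z - legOff P b i') = 0 then
            G Y (quo P (x - legOff P a i)) (quo P (z - legOff P b i')) a b else 0)) := by
        refine tsum_congr fun Y => ?_
        rw [Finset.mul_sum]
        exact Finset.sum_congr rfl fun i _ => Finset.mul_sum _ _ _
    _ = ∑ i ∈ legSet d P a, ∑ i' ∈ legSet d P b, ∑' Y, ψ Y * (legW d P a * legW d P b *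
          (if Torus.proj P (x - legOff P a i) = 0 ∧ Torus.proj P (z - legOff P b i') = 0 then
            G Y (quo P (x - legOff P a i)) (quo P (z - legOff P b i')) a b else 0)) := by
        rw [Summable.tsum_finsetSum (fun i _ => summable_sum fun i' _ => hpc i i')]
        exact Finset.sum_congr rfl fun i _ => Summable.tsum_finsetSum fun i' _ => hpc i i'
    _ = _ := by
        refine Finset.sum_congr rfl fun i _ => Finset.sum_congr rfl fun i' _ => ?_
        by_cases h : Torus.proj P (x - legOff P a i) = 0 ∧ Torus.proj P (z - legOff P b i') = 0
        · simp only [h, and_self, if_true]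
          rw [← tsum_mul_left]
          exact tsum_congr fun Y => by ring
        · simp only [h, if_false, mul_zero, tsum_zero]

/-- [folklore] **THE VERTEX SUM OF THE SANDWICH COMMUTES WITH THE LIFT** (`onLat` form, ANY two coarse spacings `N₁`, `N₂ ≠ 0`): the coarse-indexed
superposition `Σ'_v onLat N₁ ψ v · onLat N₁ (avgLift P ∘ G) v` of lifted tables is the lift of the superposition `Σ'_v onLat N₂ ψ v · onLat N₂ G v`
— both are `Σ'_Y ψ Y · (…) Y` re-indexed along `Y ↦ N•Y` (`cwsum_apply`), so the spacing at which `ψ` is extended by zero is immaterial. -/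
theorem vertexSum_avgLift (N₁ N₂ : ℕ) [NeZero N₁] [NeZero N₂] (ψ : Site (d + 1) → ℝ) (G : Site (d + 1) → MKer (d + 1) (Fib d))
    (x z : Site (d + 1)) (a b : Fib d) (hs : ∀ x' z', Summable fun Y => ψ Y * G Y x' z' a b) :
    ∑' v, onLat N₁ ψ v * onLat N₁ (fun Y => avgLift P (G Y)) v x z a b =
      avgLift P (fun x' z' a' b' => ∑' v, onLat N₂ ψ v * onLat N₂ G v x' z' a' b') x z a b := by
  have h1 := cwsum_apply (N := N₁) ψ (fun Y => avgLift P (G Y)) x z a b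
  unfold InterLevelTransport.cwsum OneStepResolventKernel.wsum at h1
  have h2 : (fun x' z' a' b' => ∑' v, onLat N₂ ψ v * onLat N₂ G v x' z' a' b') = fun x' z' a' b' => ∑' Y, ψ Y * G Y x' z' a' b' := by
    funext x' z' a' b'
    have h := cwsum_apply (N := N₂) ψ G x' z' a' b'
    unfold InterLevelTransport.cwsum OneStepResolventKernel.wsum at h
    exact h
  rw [h1, h2]
  exact tsum_mul_avgLift P ψ G x z a b hs

end Lift

/-! ## §4 The literal interface: the one-channel unit sandwich of `TaylorSandwich.sandwich_bound` across one scale -/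

section Sandwich

variable (P N Nb N' Nb' : ℕ)

/-- [folklore] The volume prefactor across one scale: `((P·N)^{d+1})⁻¹ = (P^{d+1})⁻¹·(N^{d+1})⁻¹`. -/
theorem inv_pow_mul (P N : ℕ) : ((((P * N : ℕ) : ℝ)) ^ (d + 1))⁻¹ = ((P : ℝ) ^ (d + 1))⁻¹ * ((N : ℝ) ^ (d + 1))⁻¹ := by
  push_cast
  rw [mul_pow, mul_inv]

/-- [folklore] **THE INNER FACTOR ACROSS ONE SCALE**: the big member's block-averaged vertex factor against the lifted tables is `P^{−(d+1)}` times the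
lift of the small member's vertex factor (`vertexSum_avgLift` per channel, `avgLift_finset_sum_mul` for the channel sum). -/
theorem inner_factor_eq [NeZero N'] [NeZero Nb'] (hN : Nb = P * N) (ψ : Fin (d + 1) → Site (d + 1) → ℝ) (G : Fin (d + 1) → Site (d + 1) → MKer (d + 1) (Fib d))
    (w y : Site (d + 1)) (a b : Fib d) (hV : ∀ μ x' z', Summable fun Y => ψ μ Y * G μ Y x' z' a b) :
    ∑ μ, ((Nb : ℝ) ^ (d + 1))⁻¹ * ∑' v, onLat Nb' (ψ μ) v * onLat Nb' (fun Y => avgLift P (G μ Y)) v w y a b =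
      ((P : ℝ) ^ (d + 1))⁻¹ *
        avgLift P (fun x' z' a' b' => ∑ μ, ((N : ℝ) ^ (d + 1))⁻¹ * ∑' v, onLat N' (ψ μ) v * onLat N' (G μ) v x' z' a' b') w y a b := by
  subst hN
  rw [inv_pow_mul, avgLift_finset_sum_mul, Finset.mul_sum]
  refine Finset.sum_congr rfl fun μ _ => ?_
  rw [vertexSum_avgLift P Nb' N' (ψ μ) (G μ) w y a b (hV μ)]
  ring

/-- [folklore] **«SANDWICH-DECIMATE*», GENERIC TABLE FAMILY.**  For outer legs `A`, `B`, vertex leg `ψ`, a coarse-indexed table family `G μ Y`, a factor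
`P ≠ 0` and `Nb = P·N` (the coarse spacings `N′`, `Nb′ ≠ 0` of the vertex extension are arbitrary — `ψ` is read at the coarse index on both sides):
the big member's sandwich (blocking `Nb`, tables `avgLift P (G μ Y)`) IS `P^{−(d+1)}` times the small member's sandwich (blocking `N`, tables `G μ Y`)
read against the `P`-decimated outer legs `decLeg P A`, `decLeg P B`, in `TaylorSandwich.sandwich_bound`'s LITERAL nesting.  Summability hypotheses
`hV`∕`hW`∕`hY` on the SMALL side (all three discharged from `sandwich_bound`'s hypothesis list in `sandwich_decimate_of_legs`). -/
theorem sandwich_decimate [NeZero P] [NeZero N'] [NeZero Nb'] (hN : Nb = P * N) (A B ψ : Fin (d + 1) → Site (d + 1) → ℝ)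
    (G : Fin (d + 1) → Site (d + 1) → MKer (d + 1) (Fib d))
    (hV : ∀ μ x' z' (l l' : Fin (d + 1)), Summable fun Y => ψ μ Y * G μ Y x' z' (Sum.inl l) (Sum.inl l'))
    (hW : ∀ (l : Fin (d + 1)) (i : (Fin (d + 1) → ℕ) × ℕ), i ∈ legSet d P (Sum.inl l) → ∀ (y' : Site (d + 1)) (l' : Fin (d + 1)),
      Summable fun w' : Site (d + 1) => A l (legPt P (Sum.inl l) w' i) *
        ∑ μ, ((N : ℝ) ^ (d + 1))⁻¹ * ∑' v, onLat N' (ψ μ) v * onLat N' (G μ) v w' y' (Sum.inl l) (Sum.inl l'))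
    (hY : ∀ (l' : Fin (d + 1)) (i' : (Fin (d + 1) → ℕ) × ℕ), i' ∈ legSet d P (Sum.inl l') →
      Summable fun y' : Site (d + 1) =>
        (∑' w', ∑ l, decLeg P A l w' * ∑ μ, ((N : ℝ) ^ (d + 1))⁻¹ * ∑' v, onLat N' (ψ μ) v * onLat N' (G μ) v w' y' (Sum.inl l) (Sum.inl l')) *
          B l' (legPt P (Sum.inl l') y' i')) :
    ∑' y, ∑ l', (∑' w, ∑ l, A l w *
        ∑ μ, ((Nb : ℝ) ^ (d + 1))⁻¹ * ∑' v, onLat Nb' (ψ μ) v * onLat Nb' (fun Y => avgLift P (G μ Y)) v w y (Sum.inl l) (Sum.inl l')) * B l' y =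
      ((P : ℝ) ^ (d + 1))⁻¹ * ∑' y, ∑ l', (∑' w, ∑ l, decLeg P A l w *
        ∑ μ, ((N : ℝ) ^ (d + 1))⁻¹ * ∑' v, onLat N' (ψ μ) v * onLat N' (G μ) v w y (Sum.inl l) (Sum.inl l')) * decLeg P B l' y := by
  set S : MKer (d + 1) (Fib d) :=
    fun x' z' a' b' => ∑ μ, ((N : ℝ) ^ (d + 1))⁻¹ * ∑' v, onLat N' (ψ μ) v * onLat N' (G μ) v x' z' a' b' with hS
  set p : ℝ := ((P : ℝ) ^ (d + 1))⁻¹ with hp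
  have hin : ∀ w y l l', ∑ μ, ((Nb : ℝ) ^ (d + 1))⁻¹ * ∑' v, onLat Nb' (ψ μ) v *
      onLat Nb' (fun Y => avgLift P (G μ Y)) v w y (Sum.inl l) (Sum.inl l') = p * avgLift P S w y (Sum.inl l) (Sum.inl l') :=
    fun w y l l' => inner_factor_eq P N Nb N' Nb' hN ψ G w y _ _ fun μ x' z' => hV μ x' z' l l'
  have e : ∀ y, ∑ l', (∑' w, ∑ l, A l w * ∑ μ, ((Nb : ℝ) ^ (d + 1))⁻¹ * ∑' v, onLat Nb' (ψ μ) v *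
      onLat Nb' (fun Y => avgLift P (G μ Y)) v w y (Sum.inl l) (Sum.inl l')) * B l' y =
      p * ∑ l', (∑' w, ∑ l, A l w * avgLift P S w y (Sum.inl l) (Sum.inl l')) * B l' y := by
    intro y
    rw [Finset.mul_sum]
    refine Finset.sum_congr rfl fun l' _ => ?_
    have ew : (∑' w, ∑ l, A l w * ∑ μ, ((Nb : ℝ) ^ (d + 1))⁻¹ * ∑' v, onLat Nb' (ψ μ) v *
        onLat Nb' (fun Y => avgLift P (G μ Y)) v w y (Sum.inl l) (Sum.inl l')) =
        p * ∑' w, ∑ l, A l w * avgLift P S w y (Sum.inl l) (Sum.inl l') := by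
      rw [← tsum_mul_left]
      refine tsum_congr fun w => ?_
      rw [Finset.mul_sum]
      exact Finset.sum_congr rfl fun l _ => by rw [hin]; ring
    rw [ew, mul_assoc]
  rw [tsum_congr e, tsum_mul_left, lift_adjoint_decLeg P A B S hW hY]

variable {P N Nb N'}

/-- [folklore] The three summabilities of `sandwich_decimate` from `TaylorSandwich.sandwich_bound`'s own hypothesis list for the SMALL member (table
`T μ v w l y l′ := onLat N′ (G μ) v w y (inl l) (inl l′)` with finite supports `S_w`, `S_u`, vertex leg `onLat N′ (ψ μ)`) plus the BIG member's outer-leg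
decay (blocking `Nb = P·N`): (V) the `Y`-families have finite support (`hTu`), (W) the `w̄`-families have finite support (`hTw`), (Y) the `ȳ`-families
are `sandwich_summable` for the decimated `A`-leg and ONE shifted `B`-leg point (transfers of §1). -/
theorem summable_pieces_of_legs [NeZero P] [NeZero N] [NeZero N'] (hN : Nb = P * N) {κ CA CB CH Mass RW RU : ℝ} {x' u' z' : Site (d + 1)}
    {A B ψ : Fin (d + 1) → Site (d + 1) → ℝ} {G : Fin (d + 1) → Site (d + 1) → MKer (d + 1) (Fib d)}
    {Sw Su : Site (d + 1) → Finset (Site (d + 1))} (hκ : 0 < κ)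
    (hA : ∀ l w, |A l w| ≤ CA * Real.exp (-κ * l1 (x' - quo Nb w)))
    (hB : ∀ l' y, |B l' y| ≤ CB * Real.exp (-κ * l1 (quo Nb y - z')))
    (hH : ∀ μ v, |onLat N' (ψ μ) v| ≤ CH * Real.exp (-κ * l1 (quo N v - u')))
    (hTw : ∀ μ v w l y l', onLat N' (G μ) v w y (Sum.inl l) (Sum.inl l') ≠ 0 → w ∈ Sw y)
    (hTu : ∀ μ v w l y l', onLat N' (G μ) v w y (Sum.inl l) (Sum.inl l') ≠ 0 → v ∈ Su y)
    (hRw : ∀ y, ∀ w ∈ Sw y, l1 (w - y) ≤ RW) (hRu : ∀ y, ∀ u ∈ Su y, l1 (u - y) ≤ RU)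
    (hmass : ∀ y l', ∑ w ∈ Sw y, ∑ l, ∑ μ, ∑ v ∈ Su y, |onLat N' (G μ) v w y (Sum.inl l) (Sum.inl l')| ≤ Mass) :
    (∀ μ x'' z'' (l l' : Fin (d + 1)), Summable fun Y => ψ μ Y * G μ Y x'' z'' (Sum.inl l) (Sum.inl l')) ∧
    (∀ (l : Fin (d + 1)) (i : (Fin (d + 1) → ℕ) × ℕ), i ∈ legSet d P (Sum.inl l) → ∀ (y' : Site (d + 1)) (l' : Fin (d + 1)),
      Summable fun w' : Site (d + 1) => A l (legPt P (Sum.inl l) w' i) *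
        ∑ μ, ((N : ℝ) ^ (d + 1))⁻¹ * ∑' v, onLat N' (ψ μ) v * onLat N' (G μ) v w' y' (Sum.inl l) (Sum.inl l')) ∧
    (∀ (l' : Fin (d + 1)) (i' : (Fin (d + 1) → ℕ) × ℕ), i' ∈ legSet d P (Sum.inl l') →
      Summable fun y' : Site (d + 1) =>
        (∑' w', ∑ l, decLeg P A l w' * ∑ μ, ((N : ℝ) ^ (d + 1))⁻¹ * ∑' v, onLat N' (ψ μ) v * onLat N' (G μ) v w' y' (Sum.inl l) (Sum.inl l')) *
          B l' (legPt P (Sum.inl l') y' i')) := by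
  subst hN
  have hCB : 0 ≤ CB := nonneg_of_dominated (Real.exp_pos _) (hB 0 0)
  refine ⟨fun μ x'' z'' l l' => ?_, fun l i hi y' l' => ?_, fun l' i' hi' => ?_⟩
  · -- (V) finite `Y`-support from `hTu`
    refine summable_of_ne_finset_zero (s := (Su z'').image (quo N')) fun Y hY => ?_
    have h0 : G μ Y x'' z'' (Sum.inl l) (Sum.inl l') = 0 := by
      by_contra h
      refine hY (Finset.mem_image.2 ⟨(N' : ℤ) • Y, hTu μ _ x'' l z'' l' ?_, quo_zsmul (N := N') Y⟩)
      rwa [onLat_zsmul]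
    rw [h0, mul_zero]
  · -- (W) finite `w̄`-support from `hTw`
    refine summable_of_ne_finset_zero (s := Sw y') fun w' hw' => ?_
    have h0 : ∀ μ v, onLat N' (G μ) v w' y' (Sum.inl l) (Sum.inl l') = 0 := fun μ v => by
      by_contra h
      exact hw' (hTw μ v w' l y' l' h)
    simp only [h0, mul_zero, tsum_zero, Finset.sum_const_zero]
  · -- (Y) `sandwich_summable` for the decimated `A`-leg and the shifted single `B`-leg
    have hA' : ∀ l w, |decLeg P A l w| ≤ CA * Real.exp κ * Real.exp (-κ * l1 (x' - quo N w)) :=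
      fun l w => abs_decLeg_le P N hκ.le x' hA l w
    have hB' : ∀ l'' y, |(fun l'' y => if l'' = l' then B l' (legPt P (Sum.inl l') y i') else 0) l'' y| ≤
        CB * Real.exp κ * Real.exp (-κ * l1 (quo N y - z')) := by
      intro l'' y
      by_cases hl : l'' = l'
      · simp only [hl, if_true]
        exact abs_leg_transfer' P N hκ.le z' hB l' y hi'
      · simp only [hl, if_false, abs_zero]
        positivity
    have hs := sandwich_summable (N := N) (A := decLeg P A)
      (B := fun l'' y => if l'' = l' then B l' (legPt P (Sum.inl l') y i') else 0)
      (H := fun μ v => onLat N' (ψ μ) v) (T := fun μ v w l y l' => onLat N' (G μ) v w y (Sum.inl l) (Sum.inl l'))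
      hκ hA' hB' hH hTw hTu hRw hRu hmass
    refine hs.congr fun y' => ?_
    simp only [mul_ite, mul_zero, Finset.sum_ite_eq', Finset.mem_univ, if_true]

variable (P N Nb N')

/-- [folklore] **«SANDWICH-DECIMATE*» FROM THE LEG HYPOTHESES** (generic table family): the identity of `sandwich_decimate` under `sandwich_bound`'s own
hypothesis list for the SMALL member plus the BIG member's outer-leg decay at blocking `Nb = P·N` — the form a row assembler feeds. -/
theorem sandwich_decimate_of_legs [NeZero P] [NeZero N] [NeZero N'] [NeZero Nb'] (hN : Nb = P * N) {κ CA CB CH Mass RW RU : ℝ} {x' u' z' : Site (d + 1)}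
    {A B ψ : Fin (d + 1) → Site (d + 1) → ℝ} {G : Fin (d + 1) → Site (d + 1) → MKer (d + 1) (Fib d)}
    {Sw Su : Site (d + 1) → Finset (Site (d + 1))} (hκ : 0 < κ)
    (hA : ∀ l w, |A l w| ≤ CA * Real.exp (-κ * l1 (x' - quo Nb w)))
    (hB : ∀ l' y, |B l' y| ≤ CB * Real.exp (-κ * l1 (quo Nb y - z')))
    (hH : ∀ μ v, |onLat N' (ψ μ) v| ≤ CH * Real.exp (-κ * l1 (quo N v - u')))
    (hTw : ∀ μ v w l y l', onLat N' (G μ) v w y (Sum.inl l) (Sum.inl l') ≠ 0 → w ∈ Sw y)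
    (hTu : ∀ μ v w l y l', onLat N' (G μ) v w y (Sum.inl l) (Sum.inl l') ≠ 0 → v ∈ Su y)
    (hRw : ∀ y, ∀ w ∈ Sw y, l1 (w - y) ≤ RW) (hRu : ∀ y, ∀ u ∈ Su y, l1 (u - y) ≤ RU)
    (hmass : ∀ y l', ∑ w ∈ Sw y, ∑ l, ∑ μ, ∑ v ∈ Su y, |onLat N' (G μ) v w y (Sum.inl l) (Sum.inl l')| ≤ Mass) :
    ∑' y, ∑ l', (∑' w, ∑ l, A l w *
        ∑ μ, ((Nb : ℝ) ^ (d + 1))⁻¹ * ∑' v, onLat Nb' (ψ μ) v * onLat Nb' (fun Y => avgLift P (G μ Y)) v w y (Sum.inl l) (Sum.inl l')) * B l' y =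
      ((P : ℝ) ^ (d + 1))⁻¹ * ∑' y, ∑ l', (∑' w, ∑ l, decLeg P A l w *
        ∑ μ, ((N : ℝ) ^ (d + 1))⁻¹ * ∑' v, onLat N' (ψ μ) v * onLat N' (G μ) v w y (Sum.inl l) (Sum.inl l')) * decLeg P B l' y := by
  obtain ⟨hV, hW, hY⟩ := summable_pieces_of_legs (P := P) (N' := N') hN hκ hA hB hH hTw hTu hRw hRu hmass
  exact sandwich_decimate P N Nb N' Nb' hN A B ψ G hV hW hY

/-- [folklore] **«SANDWICH-DECIMATE*», THE BOUND**: the big member's sandwich, bounded through the small member — `P^{−(d+1)}` times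
`TaylorSandwich.sandwich_bound` for the decimated outer legs (constants `CA·e^{κ}`, `CB·e^{κ}`; same rate, same `BiLoc` shape at the source block). -/
theorem abs_sandwich_decimate_le [NeZero P] [NeZero N] [NeZero N'] [NeZero Nb'] (hN : Nb = P * N) {κ CA CB CH Mass RW RU : ℝ}
    {x' u' z' : Site (d + 1)} {A B ψ : Fin (d + 1) → Site (d + 1) → ℝ} {G : Fin (d + 1) → Site (d + 1) → MKer (d + 1) (Fib d)}
    {Sw Su : Site (d + 1) → Finset (Site (d + 1))} (hκ : 0 < κ)
    (hA : ∀ l w, |A l w| ≤ CA * Real.exp (-κ * l1 (x' - quo Nb w)))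
    (hB : ∀ l' y, |B l' y| ≤ CB * Real.exp (-κ * l1 (quo Nb y - z')))
    (hH : ∀ μ v, |onLat N' (ψ μ) v| ≤ CH * Real.exp (-κ * l1 (quo N v - u')))
    (hTw : ∀ μ v w l y l', onLat N' (G μ) v w y (Sum.inl l) (Sum.inl l') ≠ 0 → w ∈ Sw y)
    (hTu : ∀ μ v w l y l', onLat N' (G μ) v w y (Sum.inl l) (Sum.inl l') ≠ 0 → v ∈ Su y)
    (hRw : ∀ y, ∀ w ∈ Sw y, l1 (w - y) ≤ RW) (hRu : ∀ y, ∀ u ∈ Su y, l1 (u - y) ≤ RU)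
    (hmass : ∀ y l', ∑ w ∈ Sw y, ∑ l, ∑ μ, ∑ v ∈ Su y, |onLat N' (G μ) v w y (Sum.inl l) (Sum.inl l')| ≤ Mass) :
    |∑' y, ∑ l', (∑' w, ∑ l, A l w *
        ∑ μ, ((Nb : ℝ) ^ (d + 1))⁻¹ * ∑' v, onLat Nb' (ψ μ) v * onLat Nb' (fun Y => avgLift P (G μ Y)) v w y (Sum.inl l) (Sum.inl l')) *
          B l' y| ≤
      ((P : ℝ) ^ (d + 1))⁻¹ * ((d + 1) * (CA * Real.exp κ * (CB * Real.exp κ) * CH * Mass *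
        (Real.exp (κ * (RW / N + (d + 1))) * Real.exp (κ * (RU / N + (d + 1))))) *
        Zl (d + 1) (κ / 2) * Real.exp (-(κ / 2) * (l1 (x' - u') + l1 (z' - u')))) := by
  rw [sandwich_decimate_of_legs P N Nb N' Nb' hN hκ hA hB hH hTw hTu hRw hRu hmass, abs_mul, abs_of_nonneg (by positivity)]
  refine mul_le_mul_of_nonneg_left ?_ (by positivity)
  subst hN
  exact sandwich_bound (N := N) (A := decLeg P A) (B := decLeg P B) (H := fun μ v => onLat N' (ψ μ) v)
    (T := fun μ v w l y l' => onLat N' (G μ) v w y (Sum.inl l) (Sum.inl l')) hκ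
    (abs_decLeg_le P N hκ.le x' hA) (abs_decLeg_le' P N hκ.le z' hB) hH hTw hTu hRw hRu hmass

/-! ### The Λ-table instance: `G μ Y := avgLift M (K μ Y)`, big table `avgLift (P·M) (K μ Y)` (leaf-11-g15's interface (b), CLAIMS l.5446) -/

/-- [folklore] **«SANDWICH-DECIMATE*» FOR STACKED LIFTS** (the R3-dL ∕ R3-dV holders' literal form): with `Mb = P·M` the big member's tables
`avgLift Mb (K μ Y) = avgLift P (avgLift M (K μ Y))` (`ScaleNesting.avgLift_avgLift'`), so `sandwich_decimate` applies with `G μ Y := avgLift M (K μ Y)`: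
the level-`Mb` sandwich at blocking `Nb = P·N` IS `P^{−(d+1)}` times the level-`M` sandwich at blocking `N` against the `P`-decimated outer legs. -/
theorem sandwich_decimate_avgLift [NeZero P] [NeZero N'] [NeZero Nb'] (M Mb : ℕ) (hN : Nb = P * N) (hM : Mb = P * M)
    (A B ψ : Fin (d + 1) → Site (d + 1) → ℝ) (K : Fin (d + 1) → Site (d + 1) → MKer (d + 1) (Fib d))
    (hV : ∀ μ x' z' (l l' : Fin (d + 1)), Summable fun Y => ψ μ Y * avgLift M (K μ Y) x' z' (Sum.inl l) (Sum.inl l'))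
    (hW : ∀ (l : Fin (d + 1)) (i : (Fin (d + 1) → ℕ) × ℕ), i ∈ legSet d P (Sum.inl l) → ∀ (y' : Site (d + 1)) (l' : Fin (d + 1)),
      Summable fun w' : Site (d + 1) => A l (legPt P (Sum.inl l) w' i) *
        ∑ μ, ((N : ℝ) ^ (d + 1))⁻¹ * ∑' v, onLat N' (ψ μ) v * onLat N' (fun Y => avgLift M (K μ Y)) v w' y' (Sum.inl l) (Sum.inl l'))
    (hY : ∀ (l' : Fin (d + 1)) (i' : (Fin (d + 1) → ℕ) × ℕ), i' ∈ legSet d P (Sum.inl l') →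
      Summable fun y' : Site (d + 1) =>
        (∑' w', ∑ l, decLeg P A l w' *
          ∑ μ, ((N : ℝ) ^ (d + 1))⁻¹ * ∑' v, onLat N' (ψ μ) v * onLat N' (fun Y => avgLift M (K μ Y)) v w' y' (Sum.inl l) (Sum.inl l')) *
          B l' (legPt P (Sum.inl l') y' i')) :
    ∑' y, ∑ l', (∑' w, ∑ l, A l w *
        ∑ μ, ((Nb : ℝ) ^ (d + 1))⁻¹ * ∑' v, onLat Nb' (ψ μ) v * onLat Nb' (fun Y => avgLift Mb (K μ Y)) v w y (Sum.inl l) (Sum.inl l')) *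
          B l' y =
      ((P : ℝ) ^ (d + 1))⁻¹ * ∑' y, ∑ l', (∑' w, ∑ l, decLeg P A l w *
        ∑ μ, ((N : ℝ) ^ (d + 1))⁻¹ * ∑' v, onLat N' (ψ μ) v * onLat N' (fun Y => avgLift M (K μ Y)) v w y (Sum.inl l) (Sum.inl l')) *
          decLeg P B l' y := by
  have e : ∀ μ Y, avgLift Mb (K μ Y) = avgLift P (avgLift M (K μ Y)) := fun μ Y => (avgLift_avgLift' hM (K μ Y)).symm
  simp only [e]
  exact sandwich_decimate P N Nb N' Nb' hN A B ψ (fun μ Y => avgLift M (K μ Y)) hV hW hY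

/-- [folklore] **«SANDWICH-DECIMATE*» FOR STACKED LIFTS, FROM THE LEG HYPOTHESES**: `sandwich_decimate_avgLift` under `TaylorSandwich.sandwich_bound`'s
own hypothesis list for the SMALL member (table `onLat N′ (fun Y => avgLift M (K μ Y))`, e.g. leaf-18's `TaylorRowLamTable` facts for the Λ table)
plus the BIG member's outer-leg decay at blocking `Nb = P·N`. -/
theorem sandwich_decimate_avgLift_of_legs [NeZero P] [NeZero N] [NeZero N'] [NeZero Nb'] (M Mb : ℕ) (hN : Nb = P * N) (hM : Mb = P * M)
    {κ CA CB CH Mass RW RU : ℝ} {x' u' z' : Site (d + 1)} {A B ψ : Fin (d + 1) → Site (d + 1) → ℝ}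
    {K : Fin (d + 1) → Site (d + 1) → MKer (d + 1) (Fib d)} {Sw Su : Site (d + 1) → Finset (Site (d + 1))} (hκ : 0 < κ)
    (hA : ∀ l w, |A l w| ≤ CA * Real.exp (-κ * l1 (x' - quo Nb w)))
    (hB : ∀ l' y, |B l' y| ≤ CB * Real.exp (-κ * l1 (quo Nb y - z')))
    (hH : ∀ μ v, |onLat N' (ψ μ) v| ≤ CH * Real.exp (-κ * l1 (quo N v - u')))
    (hTw : ∀ μ v w l y l', onLat N' (fun Y => avgLift M (K μ Y)) v w y (Sum.inl l) (Sum.inl l') ≠ 0 → w ∈ Sw y)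
    (hTu : ∀ μ v w l y l', onLat N' (fun Y => avgLift M (K μ Y)) v w y (Sum.inl l) (Sum.inl l') ≠ 0 → v ∈ Su y)
    (hRw : ∀ y, ∀ w ∈ Sw y, l1 (w - y) ≤ RW) (hRu : ∀ y, ∀ u ∈ Su y, l1 (u - y) ≤ RU)
    (hmass : ∀ y l', ∑ w ∈ Sw y, ∑ l, ∑ μ, ∑ v ∈ Su y, |onLat N' (fun Y => avgLift M (K μ Y)) v w y (Sum.inl l) (Sum.inl l')| ≤ Mass) :
    ∑' y, ∑ l', (∑' w, ∑ l, A l w *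
        ∑ μ, ((Nb : ℝ) ^ (d + 1))⁻¹ * ∑' v, onLat Nb' (ψ μ) v * onLat Nb' (fun Y => avgLift Mb (K μ Y)) v w y (Sum.inl l) (Sum.inl l')) *
          B l' y =
      ((P : ℝ) ^ (d + 1))⁻¹ * ∑' y, ∑ l', (∑' w, ∑ l, decLeg P A l w *
        ∑ μ, ((N : ℝ) ^ (d + 1))⁻¹ * ∑' v, onLat N' (ψ μ) v * onLat N' (fun Y => avgLift M (K μ Y)) v w y (Sum.inl l) (Sum.inl l')) *
          decLeg P B l' y := by
  have e : ∀ μ Y, avgLift Mb (K μ Y) = avgLift P (avgLift M (K μ Y)) := fun μ Y => (avgLift_avgLift' hM (K μ Y)).symm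
  simp only [e]
  exact sandwich_decimate_of_legs P N Nb N' Nb' (G := fun μ Y => avgLift M (K μ Y)) hN hκ hA hB hH hTw hTu hRw hRu hmass

end Sandwich

end Summit.QuantumFields.BalabanUV.Beta.GAN24.SandwichDecimate
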